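import Summits.NavierStokesRegularity.NavierStokesRegularity.Theorems.RobustBlowupPortabilityDivFreeTruncationSubst
import HarnessLib

/-!
# The collar estimate for the corrector of the averaged solenoidal truncation
  (tools for item stmt-NavierStokesRegularity-2928, `RobustBlowupPortability.DivFreeTruncation`)

On `ℝ³ = EuclideanSpace ℝ (Fin 3)`. Let `K(x, a, t) ∈ L(ℝ³)` be a smooth kernel vanishing for
`‖a‖ > ρ/16` and `𝒢(y) = ∫_{‖a‖≤ρ/16} ∫₀¹ K(y, a, t)[V(t(y − a) + a)] dt da` the corrector of the
averaged truncation of a smooth field `V`. **Main result** (`corrector_collar_estimate`): for every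
`n` there is `M = M(K, ρ, n)` — chosen BEFORE `V` — such that for every smooth `V` whose derivatives
obey `‖DʲV‖ ≤ A j` on the shell `ρ/2 ≤ ‖y‖ ≤ 2ρ` and every collar point `15ρ/16 < ‖x‖ < 2ρ`,

  `‖Dⁿ𝒢(x)‖ ≤ M (∫_{ball 0 2ρ} ‖V‖ + Σ_{j ≤ n} |A j|)`.

Proof: split at `t = 5/8` (`corrector_split`). Far part (`t ≥ 5/8`): the segment point stays in the
shell, Leibniz for the bilinear pairing `K[·]` with the kernel derivatives bounded by compactness
(`…Parametric`) and `‖Dᵏ[V(t(· − a) + a)]‖ ≤ ‖DᵏV‖ ≤ A k` (`norm_iteratedFDeriv_direct_le`). Near part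
(`t ≤ 5/8`): after the substitution `b = (1 − t)a + ty` (`corrector_near_eq_subst`) the integrand is
`K̃(y, b, t)[V(b)]` with a smooth `V`-free kernel, so `‖Dⁿ‖ ≤ (sup ‖DⁿK̃‖) ∫ ‖V‖`. Also: the corrector
is smooth (`contDiff_corrector`).

HONEST FRAMING: a calculus estimate; nothing here bears on Navier–Stokes regularity.

## References
* G. P. Galdi, *An Introduction to the Mathematical Theory of the Navier–Stokes Equations*, 2nd ed.
  (2011), §III.3 (Bogovskiĭ's formula; here replaced by an averaged Poincaré homotopy).
* M. Costabel, A. McIntosh, Math. Z. 265 (2010), §3 (regularized Poincaré operators are smoothing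
  of order `−1` with smooth kernels off the diagonal).
-/

noncomputable section

set_option linter.dupNamespace false

namespace Summit.NavierStokesRegularity.NavierStokesRegularity.Theorems

open Set MeasureTheory Filter Topology Function ContinuousLinearMap Module Metric
open scoped ContDiff

namespace DivFreeTruncation

/-- Joint smoothness of the corrector integrand `(y, (a, t)) ↦ K(y, a, t)[V(t(y − a) + a)]`.
[folklore] -/
theorem contDiff_uncurry_correctorIntegrand
    {K : EuclideanSpace ℝ (Fin 3) → EuclideanSpace ℝ (Fin 3) → ℝ →
      (EuclideanSpace ℝ (Fin 3) →L[ℝ] EuclideanSpace ℝ (Fin 3))}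
    (hK : ContDiff ℝ ∞ fun q : EuclideanSpace ℝ (Fin 3) × (EuclideanSpace ℝ (Fin 3) × ℝ) =>
      K q.1 q.2.1 q.2.2)
    {V : EuclideanSpace ℝ (Fin 3) → EuclideanSpace ℝ (Fin 3)} (hV : ContDiff ℝ ∞ V) :
    ContDiff ℝ ∞ (uncurry fun (y : EuclideanSpace ℝ (Fin 3)) (p : EuclideanSpace ℝ (Fin 3) × ℝ) =>
      K y p.1 p.2 (V (p.2 • (y - p.1) + p.1))) := by
  have h1 : ContDiff ℝ ∞ fun q : EuclideanSpace ℝ (Fin 3) × (EuclideanSpace ℝ (Fin 3) × ℝ) =>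
      V (q.2.2 • (q.1 - q.2.1) + q.2.1) := by fun_prop
  exact hK.clm_apply h1

/-- **The corrector is smooth** (smooth integrand over a compact parameter box). [folklore] -/
theorem contDiff_corrector
    {K : EuclideanSpace ℝ (Fin 3) → EuclideanSpace ℝ (Fin 3) → ℝ →
      (EuclideanSpace ℝ (Fin 3) →L[ℝ] EuclideanSpace ℝ (Fin 3))}
    (hK : ContDiff ℝ ∞ fun q : EuclideanSpace ℝ (Fin 3) × (EuclideanSpace ℝ (Fin 3) × ℝ) =>
      K q.1 q.2.1 q.2.2)
    {V : EuclideanSpace ℝ (Fin 3) → EuclideanSpace ℝ (Fin 3)} (hV : ContDiff ℝ ∞ V) (r : ℝ) :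
    ContDiff ℝ ∞ fun y => ∫ a in closedBall (0 : EuclideanSpace ℝ (Fin 3)) r, ∫ t in (0 : ℝ)..1,
      K y a t (V (t • (y - a) + a)) := by
  have heq : (fun y => ∫ a in closedBall (0 : EuclideanSpace ℝ (Fin 3)) r, ∫ t in (0 : ℝ)..1,
      K y a t (V (t • (y - a) + a))) = fun y =>
      ∫ p in closedBall (0 : EuclideanSpace ℝ (Fin 3)) r ×ˢ Icc (0 : ℝ) 1,
        K y p.1 p.2 (V (p.2 • (y - p.1) + p.1)) := by
    funext y
    exact setIntegral_intervalIntegral_eq_setIntegral_prod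
      (continuous_correctorIntegrand hK.continuous hV.continuous y) (isCompact_closedBall _ _)
      zero_le_one
  rw [heq]
  exact contDiff_setIntegral_of_contDiff (contDiff_uncurry_correctorIntegrand hK hV)
    ((isCompact_closedBall _ _).prod isCompact_Icc) volume

/-- **Far part, pointwise**: for `‖a‖ ≤ ρ/16`, `5/8 ≤ t ≤ 1` and `15ρ/16 ≤ ‖x‖ ≤ 2ρ` the segment
point stays in the shell, and Leibniz for the pairing `K[·]` gives
`‖Dⁿ[K(·,a,t)[V(t(· − a) + a)]](x)‖ ≤ 2ⁿ M_K Σ_{j≤n} |A j|` whenever `‖DⁱK(·,a,t)(x)‖ ≤ M_K`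
(`i ≤ n`). [folklore] -/
theorem norm_iteratedFDeriv_direct_le
    {K : EuclideanSpace ℝ (Fin 3) → EuclideanSpace ℝ (Fin 3) → ℝ →
      (EuclideanSpace ℝ (Fin 3) →L[ℝ] EuclideanSpace ℝ (Fin 3))}
    (hK : ContDiff ℝ ∞ fun q : EuclideanSpace ℝ (Fin 3) × (EuclideanSpace ℝ (Fin 3) × ℝ) =>
      K q.1 q.2.1 q.2.2)
    {V : EuclideanSpace ℝ (Fin 3) → EuclideanSpace ℝ (Fin 3)} (hV : ContDiff ℝ ∞ V) {ρ : ℝ}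
    {A : ℕ → ℝ} (hA : ∀ (j : ℕ) (y : EuclideanSpace ℝ (Fin 3)), ρ / 2 ≤ ‖y‖ → ‖y‖ ≤ 2 * ρ →
      ‖iteratedFDeriv ℝ j V y‖ ≤ A j)
    {n : ℕ} {MK : ℝ} (hMK0 : 0 ≤ MK) {x : EuclideanSpace ℝ (Fin 3)}
    {p : EuclideanSpace ℝ (Fin 3) × ℝ}
    (hMK : ∀ i ∈ Finset.range (n + 1), ‖iteratedFDeriv ℝ i (fun y => K y p.1 p.2) x‖ ≤ MK)
    (ha : ‖p.1‖ ≤ ρ / 16) (ht : 5 / 8 ≤ p.2) (ht1 : p.2 ≤ 1) (hx1 : 15 * ρ / 16 ≤ ‖x‖)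
    (hx2 : ‖x‖ ≤ 2 * ρ) :
    ‖iteratedFDeriv ℝ n (fun y => K y p.1 p.2 (V (p.2 • (y - p.1) + p.1))) x‖ ≤
      2 ^ n * MK * ∑ j ∈ Finset.range (n + 1), |A j| := by
  have hAbar0 : 0 ≤ ∑ j ∈ Finset.range (n + 1), |A j| :=
    Finset.sum_nonneg fun j _ => abs_nonneg (A j)
  have hf : ContDiff ℝ ∞ fun y : EuclideanSpace ℝ (Fin 3) => K y p.1 p.2 :=
    hK.comp (contDiff_id.prodMk contDiff_const)
  have hg : ContDiff ℝ ∞ fun y : EuclideanSpace ℝ (Fin 3) => V (p.2 • (y - p.1) + p.1) := by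
    have h1 : ContDiff ℝ ∞ fun y : EuclideanSpace ℝ (Fin 3) => p.2 • (y - p.1) + p.1 := by
      fun_prop
    exact hV.comp h1
  have hB : ‖ContinuousLinearMap.id ℝ (EuclideanSpace ℝ (Fin 3) →L[ℝ] EuclideanSpace ℝ (Fin 3))‖ ≤
      1 := ContinuousLinearMap.norm_id_le
  have h := ContinuousLinearMap.norm_iteratedFDeriv_le_of_bilinear_of_le_one
    (ContinuousLinearMap.id ℝ (EuclideanSpace ℝ (Fin 3) →L[ℝ] EuclideanSpace ℝ (Fin 3)))
    (n := n) hf hg x (by exact_mod_cast le_top) hB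
  simp only [ContinuousLinearMap.coe_id', id_eq] at h
  refine h.trans ?_
  have hseg1 : ρ / 2 ≤ ‖p.2 • (x - p.1) + p.1‖ := norm_segment_ge ha hx1 ht ht1
  have hseg2 : ‖p.2 • (x - p.1) + p.1‖ ≤ 2 * ρ := norm_segment_le ha hx2 (by linarith) ht1
  have hterm : ∀ i ∈ Finset.range (n + 1),
      (n.choose i : ℝ) * ‖iteratedFDeriv ℝ i (fun y => K y p.1 p.2) x‖ *
        ‖iteratedFDeriv ℝ (n - i) (fun y => V (p.2 • (y - p.1) + p.1)) x‖ ≤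
      (n.choose i : ℝ) * MK * ∑ j ∈ Finset.range (n + 1), |A j| := by
    intro i hi
    have hgi : ‖iteratedFDeriv ℝ (n - i) (fun y => V (p.2 • (y - p.1) + p.1)) x‖ ≤
        ∑ j ∈ Finset.range (n + 1), |A j| := by
      refine (norm_iteratedFDeriv_comp_segment_le hV (abs_le.2 ⟨by linarith, ht1⟩) p.1 x
        (n - i)).trans ?_
      refine (hA (n - i) _ hseg1 hseg2).trans ((le_abs_self _).trans ?_)
      exact Finset.single_le_sum (f := fun j => |A j|) (fun j _ => abs_nonneg (A j))
        (Finset.mem_range.2 (by omega))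
    have hc0 : (0 : ℝ) ≤ (n.choose i : ℝ) := Nat.cast_nonneg _
    exact mul_le_mul (mul_le_mul_of_nonneg_left (hMK i hi) hc0) hgi (norm_nonneg _)
      (mul_nonneg hc0 hMK0)
  refine (Finset.sum_le_sum hterm).trans (le_of_eq ?_)
  rw [← Finset.sum_mul, ← Finset.sum_mul]
  have hsum : ∑ i ∈ Finset.range (n + 1), (n.choose i : ℝ) = 2 ^ n := by
    rw [← Nat.cast_sum, Nat.sum_range_choose]; push_cast; ring
  rw [hsum]

/-- **Far part of the corrector** (`t ∈ [5/8, 1]`): with a uniform bound `M_K` for the kernel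
derivatives of order `≤ n` on `‖x‖ ≤ 2ρ`, for every collar point
`‖Dⁿ G₂(x)‖ ≤ 2ⁿ M_K |S × [5/8, 1]| Σ_{j≤n} |A j|`. [folklore] -/
theorem norm_iteratedFDeriv_corrector_far_le
    {K : EuclideanSpace ℝ (Fin 3) → EuclideanSpace ℝ (Fin 3) → ℝ →
      (EuclideanSpace ℝ (Fin 3) →L[ℝ] EuclideanSpace ℝ (Fin 3))}
    (hK : ContDiff ℝ ∞ fun q : EuclideanSpace ℝ (Fin 3) × (EuclideanSpace ℝ (Fin 3) × ℝ) =>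
      K q.1 q.2.1 q.2.2)
    {V : EuclideanSpace ℝ (Fin 3) → EuclideanSpace ℝ (Fin 3)} (hV : ContDiff ℝ ∞ V) {ρ : ℝ}
    {A : ℕ → ℝ} (hA : ∀ (j : ℕ) (y : EuclideanSpace ℝ (Fin 3)), ρ / 2 ≤ ‖y‖ → ‖y‖ ≤ 2 * ρ →
      ‖iteratedFDeriv ℝ j V y‖ ≤ A j)
    {n : ℕ} {MK : ℝ} (hMK0 : 0 ≤ MK)
    (hMK : ∀ i ∈ Finset.range (n + 1), ∀ x ∈ closedBall (0 : EuclideanSpace ℝ (Fin 3)) (2 * ρ),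
      ∀ p ∈ closedBall (0 : EuclideanSpace ℝ (Fin 3)) (ρ / 16) ×ˢ Icc (0 : ℝ) 1,
        ‖iteratedFDeriv ℝ i (fun y => K y p.1 p.2) x‖ ≤ MK)
    {x : EuclideanSpace ℝ (Fin 3)} (hx1 : 15 * ρ / 16 ≤ ‖x‖) (hx2 : ‖x‖ ≤ 2 * ρ) :
    ‖iteratedFDeriv ℝ n (fun y =>
        ∫ p in closedBall (0 : EuclideanSpace ℝ (Fin 3)) (ρ / 16) ×ˢ Icc (5 / 8 : ℝ) 1,
          K y p.1 p.2 (V (p.2 • (y - p.1) + p.1))) x‖ ≤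
      2 ^ n * MK * (volume : Measure (EuclideanSpace ℝ (Fin 3) × ℝ)).real
          (closedBall (0 : EuclideanSpace ℝ (Fin 3)) (ρ / 16) ×ˢ Icc (5 / 8 : ℝ) 1) *
        ∑ j ∈ Finset.range (n + 1), |A j| := by
  have hST : IsCompact (closedBall (0 : EuclideanSpace ℝ (Fin 3)) (ρ / 16) ×ˢ Icc (5 / 8 : ℝ) 1) :=
    (isCompact_closedBall _ _).prod isCompact_Icc
  have hxK : x ∈ closedBall (0 : EuclideanSpace ℝ (Fin 3)) (2 * ρ) := mem_closedBall_zero_iff.2 hx2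
  have hpt : ∀ p ∈ closedBall (0 : EuclideanSpace ℝ (Fin 3)) (ρ / 16) ×ˢ Icc (5 / 8 : ℝ) 1,
      ‖iteratedFDeriv ℝ n (fun y => K y p.1 p.2 (V (p.2 • (y - p.1) + p.1))) x‖ ≤
      2 ^ n * MK * ∑ j ∈ Finset.range (n + 1), |A j| := by
    intro p hp
    obtain ⟨hp1, hp2⟩ := hp
    rw [mem_closedBall_zero_iff] at hp1
    obtain ⟨ht, ht1⟩ := hp2
    refine norm_iteratedFDeriv_direct_le hK hV hA hMK0 (fun i hi => ?_) hp1 ht ht1 hx1 hx2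
    exact hMK i hi x hxK p ⟨mem_closedBall_zero_iff.2 hp1, ⟨by linarith, ht1⟩⟩
  refine (norm_iteratedFDeriv_setIntegral_le (contDiff_uncurry_correctorIntegrand hK hV) hST
    volume n x hpt (integrableOn_const hST.measure_lt_top.ne)).trans (le_of_eq ?_)
  rw [setIntegral_const, smul_eq_mul]
  ring

/-- Joint smoothness of the substituted kernel
`(y, (b, t)) ↦ ι(t)³ K(y, ι(t)(b − ty), t)`. [folklore] -/
theorem contDiff_uncurry_substKernel
    {K : EuclideanSpace ℝ (Fin 3) → EuclideanSpace ℝ (Fin 3) → ℝ →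
      (EuclideanSpace ℝ (Fin 3) →L[ℝ] EuclideanSpace ℝ (Fin 3))}
    (hK : ContDiff ℝ ∞ fun q : EuclideanSpace ℝ (Fin 3) × (EuclideanSpace ℝ (Fin 3) × ℝ) =>
      K q.1 q.2.1 q.2.2)
    {ι : ℝ → ℝ} (hιs : ContDiff ℝ ∞ ι) :
    ContDiff ℝ ∞ (uncurry fun (y : EuclideanSpace ℝ (Fin 3))
      (q : EuclideanSpace ℝ (Fin 3) × ℝ) => (ι q.2) ^ 3 • K y (ι q.2 • (q.1 - q.2 • y)) q.2) := by
  have h0 : ContDiff ℝ ∞ fun z : EuclideanSpace ℝ (Fin 3) × (EuclideanSpace ℝ (Fin 3) × ℝ) =>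
      (z.1, (ι z.2.2 • (z.2.1 - z.2.2 • z.1), z.2.2)) := by
    have hι' : ContDiff ℝ ∞ fun z : EuclideanSpace ℝ (Fin 3) × (EuclideanSpace ℝ (Fin 3) × ℝ) =>
        ι z.2.2 := hιs.comp (contDiff_snd.comp contDiff_snd)
    exact contDiff_fst.prodMk ((hι'.smul ((contDiff_fst.comp contDiff_snd).sub
      ((contDiff_snd.comp contDiff_snd).smul contDiff_fst))).prodMk
      (contDiff_snd.comp contDiff_snd))
  have h1 : ContDiff ℝ ∞ fun z : EuclideanSpace ℝ (Fin 3) × (EuclideanSpace ℝ (Fin 3) × ℝ) =>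
      K z.1 (ι z.2.2 • (z.2.1 - z.2.2 • z.1)) z.2.2 := hK.comp h0
  have h2 : ContDiff ℝ ∞ fun z : EuclideanSpace ℝ (Fin 3) × (EuclideanSpace ℝ (Fin 3) × ℝ) =>
      (ι z.2.2) ^ 3 := (hιs.comp (contDiff_snd.comp contDiff_snd)).pow 3
  exact h2.smul h1

/-- **Near part of the corrector** (`t ∈ [0, 5/8]`, after substitution): with a uniform bound `M₁`
for the `n`-th `x`-derivative of the substituted kernel, for `‖x‖ < 2ρ`,
`‖Dⁿ G₁(x)‖ ≤ (5/8) M₁ ∫_{ball 0 2ρ} ‖V‖`. [folklore] -/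
theorem norm_iteratedFDeriv_corrector_near_le
    {K : EuclideanSpace ℝ (Fin 3) → EuclideanSpace ℝ (Fin 3) → ℝ →
      (EuclideanSpace ℝ (Fin 3) →L[ℝ] EuclideanSpace ℝ (Fin 3))}
    (hK : ContDiff ℝ ∞ fun q : EuclideanSpace ℝ (Fin 3) × (EuclideanSpace ℝ (Fin 3) × ℝ) =>
      K q.1 q.2.1 q.2.2)
    {ρ : ℝ} (hρ : 0 < ρ) (hK0 : ∀ x a t, ρ / 16 < ‖a‖ → K x a t = 0)
    {V : EuclideanSpace ℝ (Fin 3) → EuclideanSpace ℝ (Fin 3)} (hV : ContDiff ℝ ∞ V)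
    {ι : ℝ → ℝ} (hιs : ContDiff ℝ ∞ ι) (hι : ∀ t : ℝ, t ≤ 3 / 4 → ι t = (1 - t)⁻¹)
    {n : ℕ} {M₁ : ℝ}
    (hM₁ : ∀ x ∈ closedBall (0 : EuclideanSpace ℝ (Fin 3)) (2 * ρ),
      ∀ q ∈ closedBall (0 : EuclideanSpace ℝ (Fin 3)) (3 * ρ / 2) ×ˢ Icc (0 : ℝ) (5 / 8),
        ‖iteratedFDeriv ℝ n (fun y => (ι q.2) ^ 3 • K y (ι q.2 • (q.1 - q.2 • y)) q.2) x‖ ≤ M₁)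
    {x : EuclideanSpace ℝ (Fin 3)} (hx2 : ‖x‖ < 2 * ρ) :
    ‖iteratedFDeriv ℝ n (fun y =>
        ∫ p in closedBall (0 : EuclideanSpace ℝ (Fin 3)) (ρ / 16) ×ˢ Icc (0 : ℝ) (5 / 8),
          K y p.1 p.2 (V (p.2 • (y - p.1) + p.1))) x‖ ≤
      M₁ * (5 / 8) * ∫ y in ball (0 : EuclideanSpace ℝ (Fin 3)) (2 * ρ), ‖V y‖ := by
  have hSb : IsCompact (closedBall (0 : EuclideanSpace ℝ (Fin 3)) (3 * ρ / 2)) :=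
    isCompact_closedBall _ _
  have hKx : IsCompact (closedBall (0 : EuclideanSpace ℝ (Fin 3)) (2 * ρ)) :=
    isCompact_closedBall _ _
  have hT0 : IsCompact (Icc (0 : ℝ) (5 / 8)) := isCompact_Icc
  have hxK : x ∈ closedBall (0 : EuclideanSpace ℝ (Fin 3)) (2 * ρ) :=
    mem_closedBall_zero_iff.2 hx2.le
  have heq : (fun y => ∫ p in closedBall (0 : EuclideanSpace ℝ (Fin 3)) (ρ / 16) ×ˢ
      Icc (0 : ℝ) (5 / 8), K y p.1 p.2 (V (p.2 • (y - p.1) + p.1))) =ᶠ[𝓝 x] fun y =>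
      ∫ q in closedBall (0 : EuclideanSpace ℝ (Fin 3)) (3 * ρ / 2) ×ˢ Icc (0 : ℝ) (5 / 8),
        ((ι q.2) ^ 3 • K y (ι q.2 • (q.1 - q.2 • y)) q.2) (V q.1) := by
    filter_upwards [isOpen_ball.mem_nhds (mem_ball_zero_iff.2 hx2)] with y hy
    exact corrector_near_eq_subst hK.continuous hK0 hV.continuous hιs.continuous hι
      (mem_ball_zero_iff.1 hy)
  have hKtf := contDiff_uncurry_substKernel hK hιs
  have hk : ContDiff ℝ ∞ (uncurry fun (y : EuclideanSpace ℝ (Fin 3))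
      (q : EuclideanSpace ℝ (Fin 3) × ℝ) =>
      ((ι q.2) ^ 3 • K y (ι q.2 • (q.1 - q.2 • y)) q.2) (V q.1)) :=
    hKtf.clm_apply (hV.comp (contDiff_fst.comp contDiff_snd))
  rw [(heq.iteratedFDeriv ℝ n).eq_of_nhds]
  have hpt : ∀ q ∈ closedBall (0 : EuclideanSpace ℝ (Fin 3)) (3 * ρ / 2) ×ˢ Icc (0 : ℝ) (5 / 8),
      ‖iteratedFDeriv ℝ n (fun y =>
        ((ι q.2) ^ 3 • K y (ι q.2 • (q.1 - q.2 • y)) q.2) (V q.1)) x‖ ≤ M₁ * ‖V q.1‖ := by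
    intro q hq
    have hf : ContDiff ℝ ∞ fun y : EuclideanSpace ℝ (Fin 3) =>
        (ι q.2) ^ 3 • K y (ι q.2 • (q.1 - q.2 • y)) q.2 :=
      hKtf.comp (contDiff_id.prodMk contDiff_const)
    refine (norm_iteratedFDeriv_clm_apply_const hf.contDiffAt (by exact_mod_cast le_top)).trans ?_
    rw [mul_comm]
    exact mul_le_mul_of_nonneg_right (hM₁ x hxK q hq) (norm_nonneg _)
  have hwi : IntegrableOn (fun q : EuclideanSpace ℝ (Fin 3) × ℝ => M₁ * ‖V q.1‖)
      (closedBall (0 : EuclideanSpace ℝ (Fin 3)) (3 * ρ / 2) ×ˢ Icc (0 : ℝ) (5 / 8)) volume :=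
    (continuous_const.mul (hV.continuous.comp continuous_fst).norm).continuousOn
      |>.integrableOn_compact (hSb.prod hT0)
  refine (norm_iteratedFDeriv_setIntegral_le hk (hSb.prod hT0) volume n x hpt hwi).trans ?_
  rw [integral_const_mul,
    setIntegral_prod_fst hV.continuous.norm hSb (by norm_num : (0 : ℝ) ≤ 5 / 8)]
  have hmono : ∫ b in closedBall (0 : EuclideanSpace ℝ (Fin 3)) (3 * ρ / 2), ‖V b‖ ≤
      ∫ y in ball (0 : EuclideanSpace ℝ (Fin 3)) (2 * ρ), ‖V y‖ := by
    refine setIntegral_mono_set ?_ (Eventually.of_forall fun y => norm_nonneg (V y))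
      (Eventually.of_forall (closedBall_subset_ball (by linarith)))
    exact (hV.continuous.norm.continuousOn.integrableOn_compact hKx).mono_set
      ball_subset_closedBall
  have hM₁0 : 0 ≤ M₁ := (norm_nonneg _).trans (hM₁ x hxK (0, 0)
    ⟨mem_closedBall_zero_iff.2 (by simp; positivity), ⟨le_rfl, by norm_num⟩⟩)
  calc M₁ * ((5 / 8 - 0) * ∫ b in closedBall (0 : EuclideanSpace ℝ (Fin 3)) (3 * ρ / 2), ‖V b‖)
      = M₁ * (5 / 8) * ∫ b in closedBall (0 : EuclideanSpace ℝ (Fin 3)) (3 * ρ / 2), ‖V b‖ := by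
        ring
    _ ≤ M₁ * (5 / 8) * ∫ y in ball (0 : EuclideanSpace ℝ (Fin 3)) (2 * ρ), ‖V y‖ :=
        mul_le_mul_of_nonneg_left hmono (by positivity)

/-- **The collar estimate for the corrector.** For a smooth kernel `K` vanishing for
`‖a‖ > ρ/16` and every order `n` there is `M ≥ 0` (depending on `K`, `ρ`, `n` only) such that for
every smooth `V` with shell bounds `‖DʲV‖ ≤ A j` on `ρ/2 ≤ ‖y‖ ≤ 2ρ` and every
`15ρ/16 < ‖x‖ < 2ρ`:
`‖Dⁿ𝒢(x)‖ ≤ M (∫_{ball 0 2ρ} ‖V‖ + Σ_{j ≤ n} |A j|)`,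
`𝒢(y) = ∫_{‖a‖≤ρ/16} ∫₀¹ K(y,a,t)[V(t(y−a)+a)] dt da`. [folklore] -/
theorem corrector_collar_estimate
    {K : EuclideanSpace ℝ (Fin 3) → EuclideanSpace ℝ (Fin 3) → ℝ →
      (EuclideanSpace ℝ (Fin 3) →L[ℝ] EuclideanSpace ℝ (Fin 3))}
    (hK : ContDiff ℝ ∞ fun q : EuclideanSpace ℝ (Fin 3) × (EuclideanSpace ℝ (Fin 3) × ℝ) =>
      K q.1 q.2.1 q.2.2)
    {ρ : ℝ} (hρ : 0 < ρ) (hK0 : ∀ x a t, ρ / 16 < ‖a‖ → K x a t = 0) (n : ℕ) :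
    ∃ M : ℝ, 0 ≤ M ∧ ∀ (V : EuclideanSpace ℝ (Fin 3) → EuclideanSpace ℝ (Fin 3)),
      ContDiff ℝ ∞ V → ∀ (A : ℕ → ℝ), (∀ (j : ℕ) (y : EuclideanSpace ℝ (Fin 3)), ρ / 2 ≤ ‖y‖ →
        ‖y‖ ≤ 2 * ρ → ‖iteratedFDeriv ℝ j V y‖ ≤ A j) →
      ∀ x : EuclideanSpace ℝ (Fin 3), 15 * ρ / 16 < ‖x‖ → ‖x‖ < 2 * ρ →
        ‖iteratedFDeriv ℝ n (fun y => ∫ a in closedBall (0 : EuclideanSpace ℝ (Fin 3)) (ρ / 16),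
            ∫ t in (0 : ℝ)..1, K y a t (V (t • (y - a) + a))) x‖ ≤
          M * ((∫ y in ball (0 : EuclideanSpace ℝ (Fin 3)) (2 * ρ), ‖V y‖) +
            ∑ j ∈ Finset.range (n + 1), |A j|) := by
  obtain ⟨ι, hιs, hι⟩ := exists_smooth_inv_one_sub
  have hS : IsCompact (closedBall (0 : EuclideanSpace ℝ (Fin 3)) (ρ / 16)) :=
    isCompact_closedBall _ _
  have hSb : IsCompact (closedBall (0 : EuclideanSpace ℝ (Fin 3)) (3 * ρ / 2)) :=
    isCompact_closedBall _ _
  have hKx : IsCompact (closedBall (0 : EuclideanSpace ℝ (Fin 3)) (2 * ρ)) :=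
    isCompact_closedBall _ _
  have hT1 : IsCompact (Icc (0 : ℝ) 1) := isCompact_Icc
  have hT0 : IsCompact (Icc (0 : ℝ) (5 / 8)) := isCompact_Icc
  have hT2 : IsCompact (Icc (5 / 8 : ℝ) 1) := isCompact_Icc
  -- `V`-free constants
  choose Mi hMi0 hMi using fun i => exists_forall_norm_iteratedFDeriv_apply_le
    (f := fun (y : EuclideanSpace ℝ (Fin 3)) (p : EuclideanSpace ℝ (Fin 3) × ℝ) => K y p.1 p.2)
    hK hKx (hS.prod hT1) i
  have hMK0 : 0 ≤ ∑ i ∈ Finset.range (n + 1), Mi i := Finset.sum_nonneg fun i _ => hMi0 i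
  have hMK : ∀ i ∈ Finset.range (n + 1), ∀ x ∈ closedBall (0 : EuclideanSpace ℝ (Fin 3)) (2 * ρ),
      ∀ p ∈ closedBall (0 : EuclideanSpace ℝ (Fin 3)) (ρ / 16) ×ˢ Icc (0 : ℝ) 1,
        ‖iteratedFDeriv ℝ i (fun y => K y p.1 p.2) x‖ ≤ ∑ i ∈ Finset.range (n + 1), Mi i :=
    fun i hi x hx p hp => (hMi i x hx p hp).trans
      (Finset.single_le_sum (f := Mi) (fun j _ => hMi0 j) hi)
  obtain ⟨M₁, hM₁0, hM₁⟩ := exists_forall_norm_iteratedFDeriv_apply_le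
    (contDiff_uncurry_substKernel hK hιs) hKx (hSb.prod hT0) n
  have hv₂0 : 0 ≤ (volume : Measure (EuclideanSpace ℝ (Fin 3) × ℝ)).real
      (closedBall (0 : EuclideanSpace ℝ (Fin 3)) (ρ / 16) ×ˢ Icc (5 / 8 : ℝ) 1) := measureReal_nonneg
  refine ⟨max (M₁ * (5 / 8)) (2 ^ n * (∑ i ∈ Finset.range (n + 1), Mi i) *
    (volume : Measure (EuclideanSpace ℝ (Fin 3) × ℝ)).real
      (closedBall (0 : EuclideanSpace ℝ (Fin 3)) (ρ / 16) ×ˢ Icc (5 / 8 : ℝ) 1)),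
    le_max_of_le_left (by positivity), ?_⟩
  intro V hV A hA x hx1 hx2
  have hAbar0 : 0 ≤ ∑ j ∈ Finset.range (n + 1), |A j| :=
    Finset.sum_nonneg fun j _ => abs_nonneg (A j)
  have hI0 : 0 ≤ ∫ y in ball (0 : EuclideanSpace ℝ (Fin 3)) (2 * ρ), ‖V y‖ :=
    integral_nonneg fun y => norm_nonneg _
  have hg := contDiff_uncurry_correctorIntegrand hK hV
  have hsplit : (fun y => ∫ a in closedBall (0 : EuclideanSpace ℝ (Fin 3)) (ρ / 16),
      ∫ t in (0 : ℝ)..1, K y a t (V (t • (y - a) + a))) = fun y =>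
      (∫ p in closedBall (0 : EuclideanSpace ℝ (Fin 3)) (ρ / 16) ×ˢ Icc (0 : ℝ) (5 / 8),
        K y p.1 p.2 (V (p.2 • (y - p.1) + p.1))) +
      ∫ p in closedBall (0 : EuclideanSpace ℝ (Fin 3)) (ρ / 16) ×ˢ Icc (5 / 8 : ℝ) 1,
        K y p.1 p.2 (V (p.2 • (y - p.1) + p.1)) := by
    funext y
    exact corrector_split hK.continuous hV.continuous (ρ / 16) y (by norm_num) (by norm_num)
  have hG₁s := contDiff_setIntegral_of_contDiff hg (hS.prod hT0) volume
  have hG₂s := contDiff_setIntegral_of_contDiff hg (hS.prod hT2) volume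
  rw [hsplit, fun_iteratedFDeriv_add_apply (hG₁s.contDiffAt.of_le (by exact_mod_cast le_top))
    (hG₂s.contDiffAt.of_le (by exact_mod_cast le_top))]
  have hB1 := norm_iteratedFDeriv_corrector_near_le hK hρ hK0 hV hιs hι (n := n) hM₁ hx2
  have hB2 := norm_iteratedFDeriv_corrector_far_le hK hV hA (n := n) hMK0 hMK hx1.le hx2.le
  refine (norm_add_le _ _).trans ((add_le_add hB1 hB2).trans ?_)
  rw [mul_add]
  exact add_le_add (mul_le_mul_of_nonneg_right (le_max_left _ _) hI0)
    (mul_le_mul_of_nonneg_right (le_max_right _ _) hAbar0)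

end DivFreeTruncation

end Summit.NavierStokesRegularity.NavierStokesRegularity.Theorems
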